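import Summits.QuantumFields.YangMills.Theorems.UnitScaleTiltProp7SectET3HDeltaHOfRowsT3
import Summits.QuantumFields.YangMills.Theorems.UnitScaleTiltProp7SectET3DeltaEtaExplicitT3
import HarnessLib

/-!
# Route `UnitScaleTilt`, crux «MinimiserStabilityRegPr» (stmt-QuantumFields-19200, stub EX), node N06(d = 3), route (α) — LAYER 0, ROWS (def-free):
# **THE (S)-SUB-ROW `hΔH` FOR THE LETTER OF RECORD `H46` WITH THE (3.10)-ROW DISCHARGED** — ✓`Prop7SectET3HDeltaHOfRows.hΔH_of_rows` (five displayed rows) composed with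
# ✓`Prop7SectET3DeltaEtaExplicit.h310_holds` («Δ310-EXPLICIT»: brick L0b's abstract `Δ^η` IS `η⁻²(D¹*D¹_{U₀} + Δ′₁)` with `‖Δ′₁‖ ≤ 28ε₀η²` on `RegPr`): `hΔH` at the member now rests on FOUR
# named print rows — (46)₀ `h46`, the (137) sup row `h137`, print's (139) `h139`, the (140)∕(3.49) row `h349` — with `c₃₆₉ := 28`

Cell `ym3-torus`, width seat `ym3-torus-px5` (gen 0; FILL-TO-CAP «width 5»); EX-knit namer ★ym-ust-19200-w2 g5 words (G4)∕(G6) 2026-08-28.  THEOREMS ONLY (0 `def`, 0 `sorry`);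
`--supports stmt-QuantumFields-19200 --as helper`; count-neutral.  YM₃ on T³ is ladder rung R3, NOT the Clay problem; nothing here is a claim about a stub, a crux, d = 4 or the mass
gap; nothing of [Balaban1985BackgroundPropagators] §3 is asserted.

WHAT IS PROVED (ns `…Theorems.Prop7SectET3HDeltaHOfRowsClosed`): ★★★`hΔH_of_rows'` — the two-conjunct `hΔH` text
`(∀ Y μ x, ‖D¹*_{U₀}D¹_{U₀}(H46 Y) μ x‖ ≤ BH″·η³·‖Y‖) ∧ (∀ Y ν x, ‖Δ¹_{U₀}(H46 Y) ν x‖ ≤ BH″·η³·‖Y‖)`, `BH″ := c₁₃₇ + c₁₃₉ + c₃₄₉ + 32·ε₀·BH`, on `RegPr ε₀ U₀ ∧ PosOnto ∧ PosPrime`, from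
`h46`, `h137`, `h139`, `h349` ONLY (inhabitability lines: ✓p652273's docstring).  HONEST SCOPE: a one-line composition; the four remaining rows are N06(d = 3)-class and NOT proved here.

References: T. Bałaban, CMP **102** (1985) 277–309 [Balaban1985Variational] ((137)–(140) pp.298–299, (19) p.281); CMP **99** (1985) 389–434 [Balaban1985BackgroundPropagators] ((3.10) p.392).
-/

set_option autoImplicit false

noncomputable section

open scoped InnerProductSpace ComplexConjugate Matrix.Norms.L2Operator

namespace Summit.QuantumFields.YangMills.Theorems.Prop7SectET3HDeltaHOfRowsClosed

open Literature.MathematicalPhysics.QuantumFieldTheory.Balaban1983to89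
open Literature.MathematicalPhysics.QuantumFieldTheory.Balaban1983to89.T3ContinuumYM3Torus
open Literature.MathematicalPhysics.QuantumFieldTheory.Balaban1983to89.T3PrintedRegularMinimiser (RegPr)
open T3SectALandauChart (covDerivFwdT covCodiffCurlT covLapFormT covDivFormT bgUnits eta)
open B9SectCLatticeCarrier (Bond)
open B9Eq311L2Pairing (WL2)
open B11Eq103H1Complex (SiteL2K BondL2K)
open Summit.QuantumFields.YangMills.Theorems.Prop7SectET3Transport (periodsT3)
open Summit.QuantumFields.YangMills.Theorems.Prop7SectET3HilbertLetters (W₂ toL2 toL2B DL2 DstarL2)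
open Summit.QuantumFields.YangMills.Theorems.Prop7SectET3GaugeProjector (RS)
open Summit.QuantumFields.YangMills.Theorems.Prop7SectET3WilsonHessian (DeltaEta)
open Summit.QuantumFields.YangMills.Theorems.Prop7SectET3CurvedPropagators
open Summit.QuantumFields.YangMills.Theorems.Prop7SectET3DeltaPi
open Summit.QuantumFields.YangMills.Theorems.Prop7SectET3HDeltaHOfRows (hΔH_of_rows)
open Summit.QuantumFields.YangMills.Theorems.Prop7SectET3DeltaEtaExplicit (h310_holds)

variable {F : T3Family} {n K : ℕ} {h : n ≤ K} {c₀ cB a : ℝ} [Fact (0 < c₀)] [Fact (0 < cB)]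

/-- ★★★ **THE (S)-SUB-ROW `hΔH` FROM FOUR NAMED ROWS** ([Balaban1985Variational] (137)–(140) «`D*DH`, `Δ_{U₀}H` are bounded in the norm `|·|₍₋₃₎`» at the T³ member for `H46`): the
text of ✓`hΔH_of_rows` with its (3.10)+(3.69) row `h310` DISCHARGED by ✓`Prop7SectET3DeltaEtaExplicit.h310_holds` (`c₃₆₉ = 28`), so `BH″ = c₁₃₇ + c₁₃₉ + c₃₄₉ + (28 + 4)·ε₀·BH`; displayed:
`h46` ((46)₀), `h137` (sup size of (137)'s right side), `h139` (print's (139) «`|Δ′_πHB|₍₋₃₎ ≦ O(1)|B|`»), `h349` ((140) step × (3.49)).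
[cite: Balaban1985Variational, (137)–(140) pp.298–299, (19) p.281; Balaban1985BackgroundPropagators, (3.10) p.392, (3.49) p.399, (3.126) p.420] -/
theorem hΔH_of_rows' {U₀ : GaugeField (F.P K) 0 (Matrix.specialUnitaryGroup (Fin 2) ℂ)} {ε₀ : ℝ} (hreg : RegPr F n K ε₀ U₀)
    (hp : PosOnto F n K h c₀ cB a (DeltaPiSlot F n K h c₀ cB a) U₀) (hq : PosPrime F n K h c₀ cB a U₀) {BH c137 c139 c349 : ℝ}
    (hε₀ : 0 ≤ ε₀) (hBH : 0 ≤ BH) (hc349 : 0 ≤ c349)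
    (h46 : ∀ (Y : PBond (F.P n) 0 → Matrix (Fin 2) (Fin 2) ℂ) (b : PBond (F.P K) 0), ‖H46 F n K h c₀ cB a U₀ Y b‖ ≤ BH * eta F n K * ‖Y‖)
    (h137 : ∀ (Y : PBond (F.P n) 0 → Matrix (Fin 2) (Fin 2) ℂ) (b : PBond (F.P K) 0),
      ‖(toL2 F K c₀).symm (LinearMap.adjoint (Qk F n K h c₀ cB U₀) (KinvT F n K h c₀ cB a (DeltaPiSlot F n K h c₀ cB a) U₀ (toL2B F n cB Y))
          - LinearMap.adjoint (Qk F n K h c₀ cB U₀) (((a : ℂ)) • toL2B F n cB Y)) b‖ ≤ c137 * ‖Y‖)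
    (h139 : ∀ (Y : PBond (F.P n) 0 → Matrix (Fin 2) (Fin 2) ℂ) (b : PBond (F.P K) 0),
      ‖(toL2 F K c₀).symm (LinearMap.adjoint
          (DL2 F n K c₀ U₀ ∘ₗ GprimeT F n K h c₀ cB a U₀ ∘ₗ RS F n K h c₀ cB U₀ ∘ₗ DstarL2 F n K c₀ U₀)
          (DeltaEta F n K c₀ U₀ (toL2 F K c₀ (H46 F n K h c₀ cB a U₀ Y)))) b‖ ≤ c139 * eta F n K * ‖Y‖)
    (h349 : ∀ (Y : PBond (F.P n) 0 → Matrix (Fin 2) (Fin 2) ℂ) (μ : Fin (F.P K).d) (x : Site (F.P K) 0),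
      ‖covDerivFwdT 1 (bgUnits F K U₀) μ (covDivFormT 1 (bgUnits F K U₀) (H46 F n K h c₀ cB a U₀ Y)) x‖ ≤ c349 * eta F n K ^ 3 * ‖Y‖) :
    (∀ (Y : PBond (F.P n) 0 → Matrix (Fin 2) (Fin 2) ℂ) (μ : Fin (F.P K).d) (x : Site (F.P K) 0),
        ‖covCodiffCurlT 1 (bgUnits F K U₀) (H46 F n K h c₀ cB a U₀ Y) μ x‖
          ≤ (c137 + c139 + c349 + (28 + 4) * ε₀ * BH) * eta F n K ^ 3 * ‖Y‖) ∧
    (∀ (Y : PBond (F.P n) 0 → Matrix (Fin 2) (Fin 2) ℂ) (ν : Fin (F.P K).d) (x : Site (F.P K) 0),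
        ‖covLapFormT 1 (bgUnits F K U₀) (H46 F n K h c₀ cB a U₀ Y) ν x‖
          ≤ (c137 + c139 + c349 + (28 + 4) * ε₀ * BH) * eta F n K ^ 3 * ‖Y‖) :=
  hΔH_of_rows (h := h) hreg hp hq hε₀ hBH hc349 h46 h137 h139 (h310_holds (n := n) (c₀ := c₀) U₀ hreg) h349

end Summit.QuantumFields.YangMills.Theorems.Prop7SectET3HDeltaHOfRowsClosed

end
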